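import Literature.NumberTheory.IwasawaTheory.Greenberg2016.ShaDualityTowerOfPoitouTate
import Literature.NumberTheory.GaloisRepresentations.TateDualUnramified
import Mathlib.GroupTheory.PGroup
import HarnessLib

/-!
# Greenberg 2010 Prop. 3.2.1 (γ): `Ш¹(K, Σ, T*)` is `Λ`-torsion under `LEO(𝐃)`, from the natural
# restricted Poitou–Tate Ш-duality — bookkeeping discharged (theorems only)

Topic `NumberTheory/IwasawaTheory/Greenberg2016`; namespace
`Literature.NumberTheory.IwasawaTheory.Greenberg2016`; THEOREMS ONLY (no definition, no named fact, no
`sorry`, no instance).  Lane «SUR-Λ» of cell `bsd-eis` (brick C7b part 7: the two bookkeeping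
hypotheses `hurD`, `hcard` of `dualSha_torsion_of_poitouTateNatural` discharged from `p ∈ S`),
`--supports stmt-BirchSwinnertonDyer-19032`.

* `isUnramifiedOutside_layerDualRep_torsionLayers` — `Hom(𝐃[𝔪ᵏ], μ_{p^k})` is unramified outside `S`
  (`isUnramifiedOutside_tateDual` + `isUnramifiedAt_layerRep_torsionLayers`);
* `exists_natCard_torsionBySet_eq_pow` — `#𝐃[𝔪ᵏ] = p^a` (`𝐃[𝔪ᵏ]` is killed by `p^k`: a finite
  `p`-group, `IsPGroup.iff_card`), hence `mem_of_natCard_torsionBySet_mem`: a finite place containing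
  `#𝐃[𝔪ᵏ]` contains `p`, so lies in `S`;
* **`dualSha_torsion_of_poitouTate`** — `poitouTate_shaRestricted_tateDual_natural K` + `LEO S ρ` ⇒
  `∀ y ∈ dualSha ρ e hD inv, ∃ r ≠ 0, H¹(θ̂_r) y = 0` (for any `inv` with its level law and
  «unramified ⟂ unramified», e.g. the canonical invariants): THE `hSha` OF
  `sur_of_crk_caseC_tc_of_dualSha_torsion` from the textbook named fact alone.

HONESTY: the Ш-duality is the INPUT `hX` (Milne ADT I 4.10 (a), natural form, a named fact); no case
of Greenberg's propositions and nothing about BSD is proved here.  AI formalisation, weaker than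
expert review; the statements are established only by the kernel check.

## References
* R. Greenberg, *Surjectivity of the global-to-local map defining a Selmer group*, Kyoto J. Math.
  50 (2010) 853–888, proof of Prop. 3.2.1 p. 15 L19–21, §2.1 (6) p. 7. [Greenberg2010]
* J. S. Milne, *Arithmetic Duality Theorems*, 2nd ed. (2006), I Thm. 4.10 (a), §4 p. 65. [MilneADT2006]
-/

noncomputable section

open scoped Classical
open Function NumberField IsDedekindDomain Field IsLocalRing
open _root_.TopRep _root_.ContRepresentation _root_.ContinuousCohomology
open Literature.NumberTheory.GaloisRepresentations
open Literature.NumberTheory.GaloisRepresentations.DiscreteGaloisModule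
open Literature.NumberTheory.GaloisRepresentations.DiscreteGaloisModule.TorsionLayers
open Literature.NumberTheory.GaloisCohomology
open Literature.NumberTheory.IwasawaTheory.Greenberg2006

namespace Literature.NumberTheory.IwasawaTheory.Greenberg2016

variable {K : Type} [Field K] [NumberField K] {S : Set (HeightOneSpectrum (𝓞 K))}
  {Λ : Type} [CommRing Λ] [TopologicalSpace Λ]
  {D : Type} [AddCommGroup D] [Module Λ D] [TopologicalSpace D] [DiscreteTopology D]
  [ContinuousSMul Λ D]
  (ρ : ContinuousRep (GaloisGroupUnramifiedOutside K S) Λ D)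
  {p : ℕ} [Fact p.Prime] {m : ℕ} [IsLocalRing Λ]
  (e : Λ ≃+* MvPowerSeries (Fin m) ℤ_[p]) (hD : IsCofinitelyGenerated Λ D)

omit [ContinuousSMul Λ D] in
/-- **`Hom(𝐃[𝔪ᵏ], μ_{p^k})` is unramified outside `S`** (`S ∋` the places above `p`; `𝐃[𝔪ᵏ]` is
unramified off `S`). [cite: MilneADT2006, Ch. I §0 (the module `M^D`)] [cite: Greenberg2010, §3.1 p. 14 L21–26] -/
theorem isUnramifiedOutside_layerDualRep_torsionLayers
    (hSp : ∀ w : HeightOneSpectrum (𝓞 K), ((p : ℕ) : 𝓞 K) ∈ w.asIdeal → w ∈ S) (k : ℕ) :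
    GaloisRep.IsUnramifiedOutside S ((torsionLayers ρ e hD).layerDualRep k) := by
  haveI := (torsionLayers ρ e hD).finite k
  exact isUnramifiedOutside_tateDual ((torsionLayers ρ e hD).layerRep k) hSp
    (fun w hw => isUnramifiedAt_layerRep_torsionLayers ρ e hD k hw) k

omit [NumberField K] [TopologicalSpace Λ] [TopologicalSpace D] [DiscreteTopology D] [ContinuousSMul Λ D]
  [IsLocalRing Λ] in
/-- **`#𝐃[I] = p^a` when `𝐃[I]` is finite and some power of `p` lies in `I`** (a finite abelian group
killed by `p^k` is a `p`-group, `IsPGroup.iff_card`). [cite: Greenberg2010, §2 p. 6 L1–12] -/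
theorem exists_natCard_torsionBySet_eq_pow (I : Ideal Λ) {k : ℕ} (hp : (p : Λ) ^ k ∈ I)
    [Finite ↥(Submodule.torsionBySet Λ D (I : Set Λ))] :
    ∃ a : ℕ, Nat.card ↥(Submodule.torsionBySet Λ D (I : Set Λ)) = p ^ a := by
  have hG : IsPGroup p (Multiplicative ↥(Submodule.torsionBySet Λ D (I : Set Λ))) := fun g => by
    refine ⟨k, ?_⟩
    have hx : (p ^ k) • (Multiplicative.toAdd g) = 0 := by
      apply Subtype.ext
      rw [Submodule.coe_smul_of_tower, Submodule.coe_zero, ← Nat.cast_smul_eq_nsmul Λ, Nat.cast_pow]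
      exact (Submodule.mem_torsionBySet_iff _ _).1 (Multiplicative.toAdd g).2 ⟨(p : Λ) ^ k, hp⟩
    exact congrArg Multiplicative.ofAdd hx
  obtain ⟨a, ha⟩ := IsPGroup.iff_card.1 hG
  exact ⟨a, ha⟩

omit [NumberField K] [TopologicalSpace Λ] [TopologicalSpace D] [DiscreteTopology D] [ContinuousSMul Λ D] in
/-- A finite place whose ideal contains `#𝐃[𝔪ᵏ]` contains `p`, hence lies in `S`.
[cite: Greenberg2010, §2 p. 6 L1–12] -/
theorem mem_of_natCard_torsionBySet_mem (hp : (p : Λ) ∈ maximalIdeal Λ)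
    (hSp : ∀ w : HeightOneSpectrum (𝓞 K), ((p : ℕ) : 𝓞 K) ∈ w.asIdeal → w ∈ S) (k : ℕ)
    [Finite ↥(Submodule.torsionBySet Λ D ((maximalIdeal Λ ^ k : Ideal Λ) : Set Λ))]
    (v : HeightOneSpectrum (𝓞 K))
    (h : ((Nat.card ↥(Submodule.torsionBySet Λ D ((maximalIdeal Λ ^ k : Ideal Λ) : Set Λ)) : ℕ) :
      𝓞 K) ∈ v.asIdeal) : v ∈ S := by
  obtain ⟨a, ha⟩ := exists_natCard_torsionBySet_eq_pow (D := D) (maximalIdeal Λ ^ k)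
    (Ideal.pow_mem_pow hp k)
  rw [ha, Nat.cast_pow] at h
  exact hSp v (v.isPrime.mem_of_pow_mem a h)

/-- **(γ) of Greenberg 2010 Prop. 3.2.1 from the natural restricted Poitou–Tate Ш-duality**:
`poitouTate_shaRestricted_tateDual_natural K` and `LEO(𝐃)` imply that every
`y ∈ Ш¹(K, Σ, T*) = dualSha ρ e hD inv` is killed by `H¹(θ̂_r)` for some `r ≠ 0` — the hypothesis
`hSha` of `Specification.sur_of_dualSelmer_inputs` / `sur_of_crk_caseC_tc_of_dualSha_torsion`
(`hinv`/`hUO` as in `exists_ne_zero_scalar_mem_dualSha_of_mem_dualSelmer`).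
[cite: Greenberg2010, proof of Prop. 3.2.1 (p. 15 L19–21), §2.1 (6) p. 7]
[cite: MilneADT2006, Ch. I, Thm. 4.10 (a) and §4 p. 65] -/
theorem dualSha_torsion_of_poitouTate [Finite (SigmaPlace S)] [CompactSpace (absoluteGaloisGroup K)]
    (hX : poitouTate_shaRestricted_tateDual_natural K)
    (inv : ∀ k : ℕ, LocalInvariants K (p ^ k))
    (hinv : ∀ v : Place K, InvLevelLaw inv v) (hUO : ∀ k, (inv k).UnramifiedOrthogonal)
    (hSp : ∀ w : HeightOneSpectrum (𝓞 K), ((p : ℕ) : 𝓞 K) ∈ w.asIdeal → w ∈ S)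
    (hLEO : LEO S ρ)
    (y : continuousCohomology 1 (torsionLayers ρ e hD).dualSystem.limitRep.toTopRep)
    (hy : y ∈ dualSha ρ e hD inv) :
    ∃ r : Λ, r ≠ 0 ∧ cohomologyMap (scalarDualEndHom ρ e hD r) 1 y = 0 :=
  dualSha_torsion_of_poitouTateNatural ρ e hD hX
    (isUnramifiedOutside_layerDualRep_torsionLayers ρ e hD hSp)
    (fun k v h => by
      haveI : Finite ↥(Submodule.torsionBySet Λ D ((maximalIdeal Λ ^ k : Ideal Λ) : Set Λ)) :=
        (torsionLayers ρ e hD).finite k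
      exact mem_of_natCard_torsionBySet_mem (natCast_mem_maximalIdeal_of_ringEquiv_mvPowerSeries e)
        hSp k v h)
    inv hinv hUO hSp hLEO y hy

end Literature.NumberTheory.IwasawaTheory.Greenberg2016
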